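import Mathlib
import HarnessLib
import Summits.HubbardSuperconductivity.HubbardSuperconductivity.Theorems.ChiralWindowCwChannelInfContinuousL2
import Summits.HubbardSuperconductivity.HubbardSuperconductivity.Theorems.ChiralWindowCwKLChiralWindowFiniteMeasure
import Summits.HubbardSuperconductivity.HubbardSuperconductivity.Theorems.ChiralWindowCwKLChiralWindowGradient
import Summits.HubbardSuperconductivity.HubbardSuperconductivity.Theorems.ChiralWindowCwKLChiralWindowHausdorffFinite

/-!
# `stub_klFrameHS`: the frame of the Kohn–Luttinger reduction from a Hilbert–Schmidt kernel

For the nearest-neighbour band `ε₀ = squareDispersion 1 0` and `-4 < μ < 0` the Fermi-curve measure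
`σ = fermiCurveMeasure ε₀ μ` is finite (`stub_klFiniteMeasure`, `stub_klGradient`,
`stub_klHausdorffFinite`).  Granted that the Lindhard kernel `(k, k') ↦ χ₀(k + k')` is square
integrable for `σ ⊗ σ`, the pairing form of the Kohn–Luttinger vertex `Γ_U(k, k') = U + U² χ₀(k + k')`
of any `ψ ∈ L²(σ)` splits as

`⟨ψ, Γ_U ψ⟩ = U (∫ ψ dσ)² + U² Q(ψ)`, `Q(ψ) = ∫ ψ(k) (∫ χ₀(k + k') ψ(k') dσ(k')) dσ(k)`,

(Fubini for the `L²` kernel `Γ_U` against `ψ ⊗ ψ`, linearity of the integral, and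
`∫ ψ ⊗ ψ d(σ ⊗ σ) = (∫ ψ dσ)²`), and `Q` obeys the Hilbert–Schmidt bound
`|Q(ψ)| ≤ ‖ψ‖₂² ‖χ₀(· + ·)‖_{L²(σ ⊗ σ)}` (the generic `abs_integral_mul_integral_mul_le`).
-/

noncomputable section

set_option linter.dupNamespace false

namespace Summit.HubbardSuperconductivity.HubbardSuperconductivity.Theorems

open MeasureTheory Literature.MathematicalPhysics.QuantumLattice

/-- The Kohn–Luttinger kernel `Γ_U(z.1, z.2) = U + U² χ₀(z.1 + z.2)` is in `L²(σ ⊗ σ)` as soon as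
`σ` is finite and `χ₀(· + ·) ∈ L²(σ ⊗ σ)`. [folklore] -/
theorem klhs_frame_memLp_kernel {ε : Momentum → ℝ} {μ : ℝ} (U : ℝ)
    [IsFiniteMeasure (fermiCurveMeasure ε μ)]
    (hK : MemLp (fun z : Momentum × Momentum => lindhardFunction ε μ (z.1 + z.2)) 2
      ((fermiCurveMeasure ε μ).prod (fermiCurveMeasure ε μ))) :
    MemLp (fun z : Momentum × Momentum => kohnLuttingerKernel ε μ U z.1 z.2) 2
      ((fermiCurveMeasure ε μ).prod (fermiCurveMeasure ε μ)) :=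
  (memLp_const U).add (hK.const_mul (U ^ 2))

/-- **Splitting of the pairing form** for a finite Fermi-curve measure `σ` and a Hilbert–Schmidt
Lindhard kernel: `⟨ψ, Γ_U ψ⟩ = U (∫ ψ dσ)² + U² ∫ ψ(k) (∫ χ₀(k + k') ψ(k') dσ) dσ` for `ψ ∈ L²(σ)`.
[folklore] -/
theorem klhs_frame_pairingForm_split {ε : Momentum → ℝ} {μ : ℝ} (U : ℝ) {ψ : Momentum → ℝ}
    [IsFiniteMeasure (fermiCurveMeasure ε μ)]
    (hK : MemLp (fun z : Momentum × Momentum => lindhardFunction ε μ (z.1 + z.2)) 2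
      ((fermiCurveMeasure ε μ).prod (fermiCurveMeasure ε μ)))
    (hψ : MemLp ψ 2 (fermiCurveMeasure ε μ)) :
    pairingForm ε μ U ψ =
      U * (∫ k, ψ k ∂fermiCurveMeasure ε μ) ^ 2 +
        U ^ 2 * ∫ k, ψ k * ∫ k', lindhardFunction ε μ (k + k') * ψ k'
          ∂fermiCurveMeasure ε μ ∂fermiCurveMeasure ε μ := by
  set σ := fermiCurveMeasure ε μ
  have hT : MemLp (fun z : Momentum × Momentum => ψ z.1 * ψ z.2) 2 (σ.prod σ) := memLp_two_tensor hψ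
  have hTint : Integrable (fun z : Momentum × Momentum => ψ z.1 * ψ z.2) (σ.prod σ) :=
    hT.integrable one_le_two
  have hKT : Integrable (fun z : Momentum × Momentum => lindhardFunction ε μ (z.1 + z.2) * (ψ z.1 * ψ z.2))
      (σ.prod σ) := hK.integrable_mul hT
  have h1 : pairingForm ε μ U ψ =
      ∫ z, kohnLuttingerKernel ε μ U z.1 z.2 * (ψ z.1 * ψ z.2) ∂(σ.prod σ) :=
    integral_mul_integral_mul_eq_integral_prod hψ (klhs_frame_memLp_kernel U hK)
  have h2 : ∫ k, ψ k * ∫ k', lindhardFunction ε μ (k + k') * ψ k' ∂σ ∂σ =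
      ∫ z, lindhardFunction ε μ (z.1 + z.2) * (ψ z.1 * ψ z.2) ∂(σ.prod σ) :=
    integral_mul_integral_mul_eq_integral_prod hψ hK
  calc pairingForm ε μ U ψ
      = ∫ z, kohnLuttingerKernel ε μ U z.1 z.2 * (ψ z.1 * ψ z.2) ∂(σ.prod σ) := h1
    _ = ∫ z, (U * (ψ z.1 * ψ z.2) +
          U ^ 2 * (lindhardFunction ε μ (z.1 + z.2) * (ψ z.1 * ψ z.2))) ∂(σ.prod σ) := by
        refine integral_congr_ae (Filter.Eventually.of_forall fun z => ?_)
        simp only [kohnLuttingerKernel]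
        ring
    _ = U * ∫ z, ψ z.1 * ψ z.2 ∂(σ.prod σ) +
          U ^ 2 * ∫ z, lindhardFunction ε μ (z.1 + z.2) * (ψ z.1 * ψ z.2) ∂(σ.prod σ) := by
        rw [integral_add (hTint.const_mul U) (hKT.const_mul (U ^ 2)), integral_const_mul,
          integral_const_mul]
    _ = U * (∫ k, ψ k ∂σ) ^ 2 +
          U ^ 2 * ∫ k, ψ k * ∫ k', lindhardFunction ε μ (k + k') * ψ k' ∂σ ∂σ := by
        rw [integral_prod_mul (μ := σ) (ν := σ) ψ ψ, h2, sq (∫ k, ψ k ∂σ)]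

/-- **Stub `stub_klFrameHS` (frame from Hilbert–Schmidt).** Given that `χ₀(k + k') ∈ L²(σ_μ ⊗ σ_μ)`
for all `-4 < μ < 0` (`σ_μ = fermiCurveMeasure ε₀ μ`, `ε₀ = squareDispersion 1 0`): for every such
`μ`, every `U` and every `ψ ∈ L²(σ_μ)`, `pairingForm ε₀ μ U ψ = U (∫ ψ dσ_μ)² + U² Q(ψ)` with
`Q(ψ) = ∫ ψ(k) (∫ χ₀(k + k') ψ(k') dσ_μ) dσ_μ`, and `|Q(ψ)| ≤ (∫ ψ² dσ_μ) · ‖χ₀(· + ·)‖_{L²(σ_μ ⊗ σ_μ)}`.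
[folklore] -/
theorem stub_klFrameHS :
    (∀ μ ∈ Set.Ioo (-4 : ℝ) 0,
      MemLp (fun z : Momentum × Momentum => lindhardFunction (squareDispersion 1 0) μ (z.1 + z.2)) 2
        ((fermiCurveMeasure (squareDispersion 1 0) μ).prod (fermiCurveMeasure (squareDispersion 1 0) μ))) →
    ∀ μ ∈ Set.Ioo (-4 : ℝ) 0, ∀ (U : ℝ) (ψ : Momentum → ℝ),
      MemLp ψ 2 (fermiCurveMeasure (squareDispersion 1 0) μ) →
      pairingForm (squareDispersion 1 0) μ U ψ =
          U * (∫ k, ψ k ∂fermiCurveMeasure (squareDispersion 1 0) μ) ^ 2 +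
          U ^ 2 * ∫ k, ψ k * ∫ k', lindhardFunction (squareDispersion 1 0) μ (k + k') * ψ k'
            ∂fermiCurveMeasure (squareDispersion 1 0) μ ∂fermiCurveMeasure (squareDispersion 1 0) μ ∧
      |∫ k, ψ k * ∫ k', lindhardFunction (squareDispersion 1 0) μ (k + k') * ψ k'
            ∂fermiCurveMeasure (squareDispersion 1 0) μ ∂fermiCurveMeasure (squareDispersion 1 0) μ| ≤
        (∫ k, ψ k ^ 2 ∂fermiCurveMeasure (squareDispersion 1 0) μ) *
          Real.sqrt (∫ z, (lindhardFunction (squareDispersion 1 0) μ (z.1 + z.2)) ^ 2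
            ∂(fermiCurveMeasure (squareDispersion 1 0) μ).prod (fermiCurveMeasure (squareDispersion 1 0) μ)) := by
  intro hK μ hμ U ψ hψ
  haveI : IsFiniteMeasure (fermiCurveMeasure (squareDispersion 1 0) μ) :=
    stub_klFiniteMeasure stub_klGradient stub_klHausdorffFinite μ hμ
  exact ⟨klhs_frame_pairingForm_split U (hK μ hμ) hψ, abs_integral_mul_integral_mul_le hψ (hK μ hμ)⟩

end Summit.HubbardSuperconductivity.HubbardSuperconductivity.Theorems

end
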